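import Summits.HubbardSuperconductivity.HubbardSuperconductivity.Theorems.SoloBlindOrderNotEnergyRobust
import Literature.MathematicalPhysics.QuantumLattice.SectorGroundProjContinuity
import HarnessLib

/-!
# The penalty ceiling: order that survives the penalty forces `s = O(|t| / (c L⁴))`

Solo programme `solo-HubbardSuperconductivity-blind`, structural Theorem 18(f), the quantitative
companion of the penalty transfer (Theorem 17, `SoloBlindPenaltyTransfer`) and of the entropy price
(Theorem 18, `SoloBlindSectorGibbsEntropy` ff.). Those theorems show that the summit is equivalent to
order `≥ c L⁴` in ONE ground state (or one canonical Gibbs state at an inverse temperature `β_L` with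
`β_L s_L c L² ≥ 4 log 2`) of the PENALISED Hamiltonian `H_L + s_L Δ_g†Δ_g`, for any one `s_L > 0`.
Here we bound the admissible penalty: by the gauge-twist argument of Theorem 2, SYMMETRISED over the
windings `±n` (so that the ground-state current, which the penalty does not control, cancels),

* `re_twist_energy_symm`: for EVERY unit vector `ψ` and winding `n`,
  `E(W_nᴴψ) + E(W_{-n}ᴴψ) ≤ 2 E(ψ) + 16π²|t| n²` (`E` = energy in `hubbardTorus 2 L t U`);
* `penalty_mul_order_le_of_penalised_min`: if a unit vector `φ` of a joint sector `(N, S^z)`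
  minimises the quadratic form of `H + s Δ_g†Δ_g` (`s ≥ 0`, `|g| ≤ 1`) on that sector and keeps
  order `re⟨Δ_g φ, Δ_g φ⟩ ≥ c L⁴`, then `s c L⁴ ≤ 16π²|t| M²` for every `M < L` with `M c ≥ 800`;
* `penalty_le_of_penalised_groundState_order`: the same for sector ground states
  (`IsGroundStateInSector`), and the d-wave Hubbard form with `M = ⌈800/c⌉`:
  `s ≤ 16π² ⌈800/c⌉² |t| / (c L⁴)`.

Consequently the one-temperature criterion of Theorem 18 lives at `β_L ≥ 4 log 2/(c s_L L²) =
Ω(c² L²/|t|)` on the ground-state side: the pair-rotor scale, never an `L`-independent temperature.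
(For the Gibbs-state side the same ceiling follows informally from passivity of Gibbs states; not
formalised here.) [folklore] mechanism: Bloch / Bohm (1949), Watanabe, J. Stat. Phys. 177 (2019) 717
§4; the symmetrisation is the finite-difference form of `⟨[X₁,[X₁,H]]⟩ ≥ 0` at a minimiser.
-/

namespace Summit.HubbardSuperconductivity.HubbardSuperconductivity.Theorems

open Matrix Finset Literature.MathematicalPhysics.QuantumLattice
open scoped ComplexConjugate

namespace GaugeTwist

variable {L : ℕ} [NeZero L]

/-- **Symmetrised twist energy** (`L ≥ 3`): for EVERY unit vector `ψ` (no ground-state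
hypothesis) and every winding `n`, `E(W_nᴴψ) + E(W_{-n}ᴴψ) ≤ 2E(ψ) + 16π²|t| n²`. The first-order
(current) terms of `re_twist_energy` cancel between `±n`; what is left is
`2‖ζⁿ - 1‖² re(t κ(ψ)) ≤ 2 n² (2π/L)² · 2|t|L²`. [folklore] -/
theorem re_twist_energy_symm (hL : 3 ≤ L) (t U : ℝ) {ψ : Fock (Orb (FermionTorus 2 L))}
    (h1 : star ψ ⬝ᵥ ψ = 1) (n : ℕ) :
    (star ((twistOp (n : ZMod L))ᴴ *ᵥ ψ) ⬝ᵥ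
        (hubbardTorus 2 L t U *ᵥ ((twistOp (n : ZMod L))ᴴ *ᵥ ψ))).re +
      (star ((twistOp (-(n : ZMod L)))ᴴ *ᵥ ψ) ⬝ᵥ
        (hubbardTorus 2 L t U *ᵥ ((twistOp (-(n : ZMod L)))ᴴ *ᵥ ψ))).re ≤
      2 * (star ψ ⬝ᵥ (hubbardTorus 2 L t U *ᵥ ψ)).re + 16 * Real.pi ^ 2 * |t| * (n : ℝ) ^ 2 := by
  set ζ : ℂ := (ZMod.toCircle (1 : ZMod L) : ℂ) with hζ
  set w : ℂ := (t : ℂ) * hopAmp ψ with hw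
  have hζ1 : ‖ζ‖ = 1 := Circle.norm_coe _
  have hζn : (ZMod.toCircle (n : ZMod L) : ℂ) = ζ ^ n := by
    rw [hζ, ← Circle.coe_pow, ← AddChar.map_nsmul_eq_pow, nsmul_eq_mul, mul_one]
  have hζneg : (ZMod.toCircle (-(n : ZMod L)) : ℂ) = conj (ζ ^ n) := by
    rw [AddChar.map_neg_eq_inv, Circle.coe_inv_eq_conj, hζn]
  rw [re_twist_energy hL _ t U ψ, re_twist_energy hL _ t U ψ, hζn, hζneg]
  have han : ‖ζ ^ n‖ = 1 := by rw [norm_pow, hζ1, one_pow]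
  have hren : (ζ ^ n - 1).re = -‖ζ ^ n - 1‖ ^ 2 / 2 := re_sub_one_eq_of_norm_eq_one han
  have e₁ : ((ζ ^ n - 1) * w).re = (ζ ^ n - 1).re * w.re - (ζ ^ n).im * w.im := by
    simp [Complex.mul_re]
  have e₂ : ((conj (ζ ^ n) - 1) * w).re = (ζ ^ n - 1).re * w.re + (ζ ^ n).im * w.im := by
    rw [Complex.mul_re, Complex.sub_re, Complex.sub_im, Complex.conj_re, Complex.conj_im,
      Complex.one_re, Complex.one_im, Complex.sub_re, Complex.one_re]
    ring
  rw [← hw, e₁, e₂, hren]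
  have hL0 : (0 : ℝ) < L := by exact_mod_cast (show 0 < L by omega)
  have hprod : ‖ζ ^ n - 1‖ ^ 2 * ‖w‖ ≤ (n : ℝ) ^ 2 * (8 * Real.pi ^ 2 * |t|) := by
    have ha : ‖ζ ^ n - 1‖ ^ 2 ≤ (n : ℝ) ^ 2 * (2 * Real.pi / L) ^ 2 := by
      have h1' := norm_pow_sub_one_le_of_norm_eq_one hζ1 n
      have h2' := norm_toCircle_one_sub_one_le (L := L)
      calc ‖ζ ^ n - 1‖ ^ 2 ≤ (n * ‖ζ - 1‖) ^ 2 := by gcongr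
        _ ≤ (n * (2 * Real.pi / L)) ^ 2 := by gcongr
        _ = (n : ℝ) ^ 2 * (2 * Real.pi / L) ^ 2 := by ring
    have hb : ‖w‖ ≤ |t| * (2 * (L : ℝ) ^ 2) := by
      rw [hw, norm_mul, Complex.norm_real, Real.norm_eq_abs]
      exact mul_le_mul_of_nonneg_left (norm_hopAmp_le h1) (abs_nonneg t)
    calc ‖ζ ^ n - 1‖ ^ 2 * ‖w‖
        ≤ ((n : ℝ) ^ 2 * (2 * Real.pi / L) ^ 2) * (|t| * (2 * (L : ℝ) ^ 2)) :=
          mul_le_mul ha hb (norm_nonneg _) (by positivity)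
      _ = (n : ℝ) ^ 2 * (8 * Real.pi ^ 2 * |t|) := by field_simp; ring
  have hwre : ‖ζ ^ n - 1‖ ^ 2 * w.re ≤ ‖ζ ^ n - 1‖ ^ 2 * ‖w‖ :=
    mul_le_mul_of_nonneg_left (Complex.re_le_norm w) (sq_nonneg _)
  nlinarith [hprod, hwre]

end GaugeTwist

open GaugeTwist

variable {L : ℕ} [NeZero L]

/-- **Penalty ceiling for penalised minimisers.** Let `φ` be a unit vector of the joint sector
`(N, S^z = Mz)` minimising the quadratic form of `H + s Δ_g†Δ_g` on that sector
(`H = hubbardTorus 2 L t U`, `s ≥ 0`, `|g| ≤ 1`), with order `re⟨Δ_g φ, Δ_g φ⟩ ≥ c L⁴`. Then for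
every `M < L` with `M c ≥ 800`: `s c L⁴ ≤ 16π²|t| M²`. Proof: compare `φ` with its `2M` twisted
copies `W_{±j}ᴴφ`, `1 ≤ j ≤ M` (same sector, unit): the penalised energy cannot decrease, the kinetic
energy of the pair `±j` rises by at most `16π²|t|j²` (`re_twist_energy_symm`), and the twisted orders
sum to at most `400L⁴` over all windings (`sum_twist_pairField_order_le`), so
`2M s cL⁴ ≤ 16π²|t| M³ + 800 s L⁴ ≤ 16π²|t| M³ + M s c L⁴`. [folklore] -/
theorem penalty_mul_order_le_of_penalised_min (hL : 3 ≤ L) (t U : ℝ) {N : ℕ} {Mz : ℝ}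
    (g : (Fin 2 → ℤ) → ℝ) (hg : ∀ e, |g e| ≤ 1) {s c : ℝ} (hs : 0 ≤ s) {M : ℕ} (hML : M < L)
    (hMc : 800 ≤ (M : ℝ) * c) {φ : Fock (Orb (FermionTorus 2 L))} (hφK : φ ∈ szSector N Mz)
    (hφ1 : star φ ⬝ᵥ φ = 1)
    (hmin : ∀ ψ ∈ szSector (Λ := FermionTorus 2 L) N Mz, star ψ ⬝ᵥ ψ = 1 →
      (star φ ⬝ᵥ ((hubbardTorus 2 L t U + (s : ℂ) • ((pairField g L)ᴴ * pairField g L)) *ᵥ φ)).re ≤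
        (star ψ ⬝ᵥ ((hubbardTorus 2 L t U + (s : ℂ) • ((pairField g L)ᴴ * pairField g L)) *ᵥ ψ)).re)
    (hord : c * (L : ℝ) ^ 4 ≤ (star (pairField g L *ᵥ φ) ⬝ᵥ (pairField g L *ᵥ φ)).re) :
    s * c * (L : ℝ) ^ 4 ≤ 16 * Real.pi ^ 2 * |t| * (M : ℝ) ^ 2 := by
  classical
  set H := hubbardTorus 2 L t U with hH
  set Δ := pairField g L with hΔ
  set Tw : ZMod L → ℝ := fun m =>
    (star (Δ *ᵥ ((twistOp m)ᴴ *ᵥ φ)) ⬝ᵥ (Δ *ᵥ ((twistOp m)ᴴ *ᵥ φ))).re with hTw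
  set Ew : ZMod L → ℝ := fun m =>
    (star ((twistOp m)ᴴ *ᵥ φ) ⬝ᵥ (H *ᵥ ((twistOp m)ᴴ *ᵥ φ))).re with hEw
  set E₀ : ℝ := (star φ ⬝ᵥ (H *ᵥ φ)).re with hE₀
  set T₀ : ℝ := (star (Δ *ᵥ φ) ⬝ᵥ (Δ *ᵥ φ)).re with hT₀
  -- the penalised quadratic form splits into energy and order
  have hsplit : ∀ ψ : Fock (Orb (FermionTorus 2 L)),
      (star ψ ⬝ᵥ ((H + (s : ℂ) • (Δᴴ * Δ)) *ᵥ ψ)).re =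
        (star ψ ⬝ᵥ (H *ᵥ ψ)).re + s * (star (Δ *ᵥ ψ) ⬝ᵥ (Δ *ᵥ ψ)).re := by
    intro ψ
    rw [add_mulVec, smul_mulVec, dotProduct_add, dotProduct_smul, ← mulVec_mulVec,
      dotProduct_mulVec _ Δᴴ, ← star_mulVec, Complex.add_re, smul_eq_mul, Complex.re_ofReal_mul]
  -- the variational inequality for each twisted copy
  have hvar : ∀ m : ZMod L, E₀ + s * T₀ ≤ Ew m + s * Tw m := by
    intro m
    have h := hmin ((twistOp m)ᴴ *ᵥ φ) (twist_mem_szSector m hφK)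
      (by rw [star_twist_dotProduct_twist, hφ1])
    rw [hsplit, hsplit] at h
    exact h
  -- twisted orders are nonnegative and sum to at most `400 L⁴`
  have hTw0 : ∀ m, 0 ≤ Tw m := fun m => by
    simp only [hTw]
    rw [← norm_toLp_sq_eq_re]
    positivity
  have htot : ∑ m : ZMod L, Tw m ≤ 400 * (L : ℝ) ^ 4 := by
    have := sum_twist_pairField_order_le g hg φ
    rwa [hφ1, Complex.one_re, mul_one] at this
  -- the windings `1..M` and their negatives embed into `ℤ/L`
  set S : Finset ℕ := Finset.Icc 1 M with hS
  have hinj : ∀ i ∈ S, ∀ j ∈ S, ((i : ℕ) : ZMod L) = ((j : ℕ) : ZMod L) → i = j := by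
    intro i hi j hj hij
    rw [hS, Finset.mem_Icc] at hi hj
    have := (ZMod.natCast_eq_natCast_iff' i j L).1 hij
    rwa [Nat.mod_eq_of_lt (by omega), Nat.mod_eq_of_lt (by omega)] at this
  have hinj' : ∀ i ∈ S, ∀ j ∈ S, (fun k : ℕ => -((k : ℕ) : ZMod L)) i =
      (fun k : ℕ => -((k : ℕ) : ZMod L)) j → i = j :=
    fun i hi j hj hij => hinj i hi j hj (neg_injective hij)
  have hpos : ∑ j ∈ S, Tw (j : ZMod L) ≤ 400 * (L : ℝ) ^ 4 :=
    calc ∑ j ∈ S, Tw (j : ZMod L) = ∑ m ∈ S.image (fun k : ℕ => ((k : ℕ) : ZMod L)), Tw m :=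
          (Finset.sum_image hinj).symm
      _ ≤ ∑ m : ZMod L, Tw m :=
          Finset.sum_le_sum_of_subset_of_nonneg (Finset.subset_univ _) fun m _ _ => hTw0 m
      _ ≤ 400 * (L : ℝ) ^ 4 := htot
  have hneg : ∑ j ∈ S, Tw (-(j : ZMod L)) ≤ 400 * (L : ℝ) ^ 4 :=
    calc ∑ j ∈ S, Tw (-(j : ZMod L)) = ∑ m ∈ S.image (fun k : ℕ => -((k : ℕ) : ZMod L)), Tw m :=
          (Finset.sum_image hinj').symm
      _ ≤ ∑ m : ZMod L, Tw m :=
          Finset.sum_le_sum_of_subset_of_nonneg (Finset.subset_univ _) fun m _ _ => hTw0 m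
      _ ≤ 400 * (L : ℝ) ^ 4 := htot
  -- per winding: `2 s T₀ ≤ 16π²|t| M² + s (T(j) + T(-j))`
  have hstep : ∀ j ∈ S, 2 * s * T₀ ≤
      16 * Real.pi ^ 2 * |t| * (M : ℝ) ^ 2 + s * (Tw (j : ZMod L) + Tw (-(j : ZMod L))) := by
    intro j hj
    rw [hS, Finset.mem_Icc] at hj
    have hen := re_twist_energy_symm hL t U hφ1 j
    have h₁ := hvar (j : ZMod L)
    have h₂ := hvar (-(j : ZMod L))
    have hjM : (j : ℝ) ^ 2 ≤ (M : ℝ) ^ 2 := by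
      have : (j : ℝ) ≤ M := by exact_mod_cast hj.2
      gcongr
    have hEj : Ew (j : ZMod L) + Ew (-(j : ZMod L)) ≤
        2 * E₀ + 16 * Real.pi ^ 2 * |t| * (j : ℝ) ^ 2 := hen
    have hjM' := mul_le_mul_of_nonneg_left hjM (by positivity : (0 : ℝ) ≤ 16 * Real.pi ^ 2 * |t|)
    linarith [hEj, h₁, h₂, hjM']
  -- sum over the windings
  have hsum := Finset.sum_le_sum hstep
  rw [Finset.sum_const, hS, Nat.card_Icc, Nat.add_sub_cancel, nsmul_eq_mul, Finset.sum_add_distrib,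
    Finset.sum_const, Nat.card_Icc, Nat.add_sub_cancel, nsmul_eq_mul, ← Finset.mul_sum,
    Finset.sum_add_distrib] at hsum
  have hM0 : (0 : ℝ) < M := by
    rcases Nat.eq_zero_or_pos M with h | h
    · exfalso; rw [h, Nat.cast_zero, zero_mul] at hMc; linarith
    · exact_mod_cast h
  have hL4 : (0 : ℝ) ≤ (L : ℝ) ^ 4 := by positivity
  have hT₀c : c * (L : ℝ) ^ 4 ≤ T₀ := hord
  -- `2 M s T₀ ≤ 16π²|t| M³ + 800 s L⁴`, `800 s L⁴ ≤ M c s L⁴`, `M s c L⁴ ≤ M s T₀`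
  have h800 : s * (800 * (L : ℝ) ^ 4) ≤ s * ((M : ℝ) * c * (L : ℝ) ^ 4) :=
    mul_le_mul_of_nonneg_left (by nlinarith) hs
  have hkey : (M : ℝ) * (s * c * (L : ℝ) ^ 4) ≤ (M : ℝ) * (16 * Real.pi ^ 2 * |t| * (M : ℝ) ^ 2) := by
    nlinarith [hsum, hpos, hneg, h800, mul_le_mul_of_nonneg_left hT₀c hs, hM0.le]
  exact le_of_mul_le_mul_left hkey hM0

/-- **Penalty ceiling for penalised sector ground states** (`IsGroundStateInSector` form of
`penalty_mul_order_le_of_penalised_min`). [folklore] -/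
theorem penalty_mul_order_le_of_penalised_groundState (hL : 3 ≤ L) (t U : ℝ) {N : ℕ} {Mz : ℝ}
    (g : (Fin 2 → ℤ) → ℝ) (hg : ∀ e, |g e| ≤ 1) {s c : ℝ} (hs : 0 ≤ s) {M : ℕ} (hML : M < L)
    (hMc : 800 ≤ (M : ℝ) * c) {φ : Fock (Orb (FermionTorus 2 L))}
    (hφ : IsGroundStateInSector
      (hubbardTorus 2 L t U + (s : ℂ) • ((pairField g L)ᴴ * pairField g L)) N Mz φ)
    (hφ1 : star φ ⬝ᵥ φ = 1)
    (hord : c * (L : ℝ) ^ 4 ≤ (star (pairField g L *ᵥ φ) ⬝ᵥ (pairField g L *ᵥ φ)).re) :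
    s * c * (L : ℝ) ^ 4 ≤ 16 * Real.pi ^ 2 * |t| * (M : ℝ) ^ 2 := by
  set B := hubbardTorus 2 L t U + (s : ℂ) • ((pairField g L)ᴴ * pairField g L) with hB
  have hBh : B.IsHermitian :=
    isHermitian_add_ofReal_smul (hubbardTorus_isHermitian hL t U)
      (isHermitian_conjTranspose_mul_self _) s
  obtain ⟨hmem, -, heig⟩ := hφ
  have hE : (star φ ⬝ᵥ (B *ᵥ φ)).re = B.minEnergyOn (szSector N Mz) := by
    rw [heig, dotProduct_smul, hφ1, smul_eq_mul, mul_one, Complex.ofReal_re]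
  refine penalty_mul_order_le_of_penalised_min hL t U g hg hs hML hMc hmem hφ1 ?_ hord
  intro ψ hψ hψ1
  rw [hE]
  exact minEnergyOn_le_rayleigh_of_mem hBh _ hψ hψ1

/-- **The d-wave penalty ceiling.** If a unit sector ground state of the order-penalised Hubbard
torus `hubbardTorus 2 L t U + s Δ_d†Δ_d` (`s ≥ 0`, `c > 0`, `L > ⌈800/c⌉`, `L ≥ 3`) has d-wave
order `re⟨Δ_d φ, Δ_d φ⟩ ≥ c L⁴`, then `s ≤ 16π² ⌈800/c⌉² |t| / (c L⁴)`: order of size `L⁴` survives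
only penalties of coupling `O(|t| c⁻³ L⁻⁴)`. With Theorem 18 (`β_L s_L c L² ≥ 4 log 2`) the
one-temperature criterion on the ground-state side therefore needs
`β_L ≥ log 2 · L² / (4π² ⌈800/c⌉² |t|)`, i.e. `β_L = Ω(c² L² / |t|)`. [folklore] -/
theorem penalty_le_of_dWave_groundState_order (t U : ℝ) {s c : ℝ} (hs : 0 ≤ s) (hc : 0 < c)
    (hL3 : 3 ≤ L) (hL : ⌈800 / c⌉₊ < L) {N : ℕ} {Mz : ℝ} {φ : Fock (Orb (FermionTorus 2 L))}
    (hφ : IsGroundStateInSector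
      (hubbardTorus 2 L t U + (s : ℂ) • ((pairField dWaveFormFactor L)ᴴ * pairField dWaveFormFactor L))
      N Mz φ)
    (hφ1 : star φ ⬝ᵥ φ = 1)
    (hord : c * (L : ℝ) ^ 4 ≤
      (star (pairField dWaveFormFactor L *ᵥ φ) ⬝ᵥ (pairField dWaveFormFactor L *ᵥ φ)).re) :
    s ≤ 16 * Real.pi ^ 2 * (⌈800 / c⌉₊ : ℝ) ^ 2 * |t| / (c * (L : ℝ) ^ 4) := by
  have hMc : 800 ≤ (⌈800 / c⌉₊ : ℝ) * c := by
    have h := Nat.le_ceil (800 / c)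
    rw [div_le_iff₀ hc] at h
    exact h
  have hkey := penalty_mul_order_le_of_penalised_groundState hL3 t U dWaveFormFactor
    abs_dWaveFormFactor_le_one hs hL hMc hφ hφ1 hord
  have hL0 : (0 : ℝ) < (L : ℝ) ^ 4 := by
    have : (0 : ℝ) < L := by exact_mod_cast (show 0 < L by omega)
    positivity
  rw [le_div_iff₀ (mul_pos hc hL0)]
  nlinarith [hkey]

end Summit.HubbardSuperconductivity.HubbardSuperconductivity.Theorems
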